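import Summits.ResolutionOfSingularities.ResolutionOfSingularities.Theorems.EquisingularLiftEquisingularLiftNatModelChainStep
import Summits.ResolutionOfSingularities.ResolutionOfSingularities.Theorems.EquisingularLiftEquisingularLiftNatPointResolution
import Summits.ResolutionOfSingularities.ResolutionOfSingularities.Theorems.EquisingularLiftEquisingularLiftProjectiveAmbientIntegralFibre
import HarnessLib

/-!
# [OURS · L1 W4.5(b) · EL♮] T-ISO-0⁺ (STRONG FORM) «DOWNSTAIRS EMBEDDED RESOLUTIONS BY POINTS AND FRESH-CARRIER Δ-STEPS LIFT», any `n`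
# (res-L1-w45b-lead-2 2026-08-27T06:44:38Z «point-resolvable modulo finitely many Δ-steps at equimultiple points»; named to
# res-D-pv-029 by res-L1-w45b-plan-1 ORDERS AMENDMENT 2 (c) 06:53:05Z; kit K4 = the assembly over K2 `modelStep` p509016,
# K3 `modelPointStep` p510112 and K3b `modelPointStep_chain'` p511521/p512154)

Crux `EquisingularLiftNat` = stmt-ResolutionOfSingularities-20038 (route EquisingularLift), line `sections`; helper file
`--supports … --as helper`. HONEST FRAMING: OURS (cell res-hironaka, slot W4.5(b)); NOT a statement of any manuscript; a RUNG of the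
research stub `stub_elnat_three_isolated_nonabs` (the first one that uses a non-section device). AI-written, weaker than expert review.
No `sorry`; standard axioms.

THIS FILE supersedes `…NatDeltaPointResolution.lean` (p512946, same seat, 20 minutes earlier): the theorem there,
`target_elnat_of_deltaPointResolution`, asks the downstairs (pt;Δ) constructor for the extra clause «`T₂ ⊄ supp Z`»; here
(`target_elnat_of_deltaPointResolution'`) that clause is DROPPED — it is automatic, because the lift hypothesis puts `supp Z` inside the
exceptional locus `υ⁻¹{x}`, which the strict transform `T₂` leaves — so that res-L1-w45b-lead-2's registered skeleton-v5 stub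
`stub_elnat_tcDeltaPointResolution` (TARGET-T-ISO-0PLUS.lean 1a0a0b57736ee38a) is a literal instance (T-INST); append-only tree ⇒ new file.

THE RUNG (`target_elnat_of_deltaPointResolution'`). Fix a prime `p`, an algebraically closed field `k` of characteristic `p`, an
integral hypersurface `H ⊆ ℙⁿ_k` (the item's hypotheses, verbatim from T-ISO-0 `target_elnat_of_pointResolution`, p505885). Parameters:
a DOWNSTAIRS ADMISSIBILITY PREDICATE `Adm F₁ F₂ υ x Z` on (the point step `υ : F₂ = Bl_x F₁ → F₁` and the trace ideal `Z` on `F₂`) and the LIFT HYPOTHESIS `HΔ(Adm)` — the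
consumer form of res-type-100's T-CARRIER-Δ: in every section-blow-up situation over a complete DVR `O ↠ k` (integral regular
ambient `X'` proper over `O`, smooth near the section `s`, `τ₁ : X₁ → X'` the blow-up of `ker s`, and a MODEL SQUARE
`j₂ : F₂ → X₁` of the special fibre of `X₁` over `Spec k → Spec O`, sitting over the model square `j : F₁ → X'` of the previous stage
with `s(𝔪) = j x`, `υ : F₂ → F₁` the blow-up of the reduced point `x`, `j₂ ≫ τ₁ = υ ≫ j`, and the CARRIER IDENTITY
`(ker s · 𝒪_{X₁}) · 𝒪_{F₂} = 𝔪_x · 𝒪_{F₂}`), every admissible trace `Z` has an upstairs centre `C` — regular, `O`-flat, inside the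
carrier, with `C · 𝒪_{F₂} = Z`.
HYPOTHESIS (downstairs, ∃-form): `(ℙⁿ_k, 𝟙, range ι)` reaches a triple `(F', ρ', T')` with REGULAR reduced strict transform
`V(closure T')_red` through the inductive closure under
 (pt) blow up the ambient `F₁` at a point `x` of `V(closure T₁)_red` that is closed in `F₁`, NON-REGULAR on `V(closure T₁)_red` and
      REGULAR ON THE AMBIENT `F₁` (a good point), `T₂ = closure υ⁻¹(T₁ ∖ {x})`;
 (pt;Δ) the same point step followed AT ONCE by the blow-up of `F₂` along an ADMISSIBLE trace `Z` of the fresh carrier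
      `E_x = 𝔪_x · 𝒪_{F₂}` with `supp Z ⊆ T₂` (E1), `T₃ = closure υ₂⁻¹(T₂ ∖ supp Z)` (that `T₂ ⊄ supp Z` is automatic: the lift puts
      `supp Z` inside the exceptional locus `υ⁻¹{x}`, which the strict transform `T₂` leaves).
CONCLUSION: the HORIZONTAL form of EL♮ for `H` (T-ISO-0's conclusion verbatim): over `O = W(k)`, a horizontal E1 chain out of
`(ℙⁿ_O, 𝟙, Y)` with regular reduced strict transform.

PROOF = induction along the downstairs closure carrying the SPECIAL-FIBRE MODEL SQUARE (K2/K3): the downstairs ambient IS the special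
fibre of the upstairs ambient (`IsPullback j t (σ' ≫ q) (Spec π)`, base case `ProjectiveAmbientFibre.isPullback_projMap`) with
`j '' T = S'`; (pt) = `modelPointStep`; (pt;Δ) = `modelPointStep`, then `HΔ`, then `modelStep`; the end transports regularity along
`V_F(T)_red ≅ V_{X'}(j '' T)_red` (`isRegular_subscheme_vanishingIdeal_image_iff`). With `Adm := ⊥` this re-proves T-ISO-0 with the
extra (harmless downstairs) clause «good point». LIMITS (said, not hidden): Δ-steps only in FRESH carriers; later point steps only at
REGULAR ambient points (bad points of Δ-steps with singular traces need the multisection device — res-D-pv-013's T-TAIL p508794).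

References: …NatModelStep (p509016), …NatModelPointStep (p510112), …NatModelChainStep (p511521/p512154), …NatPointResolution (p505885);
Liu 2002 §8.1; Stacks 0805/056P; res-L1-w45b-lead-2 LEAD-MEMO-2 §4–§6 (OURS planning text, index only).
-/

set_option linter.dupNamespace false -- mandated namespace `Summit.<Summit>.<Problem>` of this single-conjunct summit
set_option linter.overlappingInstances false -- signatures carry `[IsDomain O] [IsDiscreteValuationRing O]`

noncomputable section

open CategoryTheory CategoryTheory.Limits AlgebraicGeometry TopologicalSpace Topology
open MvPolynomial
open Literature.AlgebraicGeometry.Resolution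
open AlgebraicGeometry.Scheme.IdealSheafData
open Summit.ResolutionOfSingularities.ResolutionOfSingularities.Theses.EquisingularLift.Split
open Summit.ResolutionOfSingularities.ResolutionOfSingularities.Cruxes.EquisingularLift.StrataSplit

namespace Summit.ResolutionOfSingularities.ResolutionOfSingularities.Cruxes.EquisingularLiftNat.Sections

/-! ## The rung -/

/-- **T-ISO-0⁺ «downstairs embedded resolutions by points and fresh-carrier Δ-steps lift to horizontal E1 chains»** (any `n`;
parametric in the downstairs admissibility predicate `Adm`, conditional on the lift hypothesis `HΔ(Adm)` = consumer form of
T-CARRIER-Δ). See the module docstring. [folklore; assembly of p509016, p510112, p511521 over the T-ISO-0 base block p505885] -/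
theorem target_elnat_of_deltaPointResolution' (p : ℕ) : p.Prime → ∀ (k : Type) [Field k] [CharP k p] [IsAlgClosed k] (n : ℕ)
    (H : AlgebraicGeometry.Scheme.{0}) (ι : H ⟶ (Literature.AlgebraicGeometry.Motives.projectiveSpace n k).left),
    AlgebraicGeometry.IsClosedImmersion ι → AlgebraicGeometry.IsIntegral H →
    (∀ y : (Literature.AlgebraicGeometry.Motives.projectiveSpace n k).left,
      ∃ U : (Literature.AlgebraicGeometry.Motives.projectiveSpace n k).left.affineOpens,
        y ∈ (U : (Literature.AlgebraicGeometry.Motives.projectiveSpace n k).left.Opens) ∧ (ι.ker.ideal U).IsPrincipal) →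
    -- the downstairs admissibility predicate of carrier traces and the LIFT HYPOTHESIS HΔ(Adm)
    ∀ (Adm : ∀ (F₁ F₂ : AlgebraicGeometry.Scheme.{0}), (F₂ ⟶ F₁) → F₁ → F₂.IdealSheafData → Prop),
    (∀ (O : Type) [CommRing O] [IsDomain O] [IsDiscreteValuationRing O] [IsAdicComplete (IsLocalRing.maximalIdeal O) O]
        [IsAlgClosed (IsLocalRing.ResidueField O)] (θ : O →+* k), Function.Surjective θ →
      ∀ (X' : AlgebraicGeometry.Scheme.{0}) (r' : X' ⟶ AlgebraicGeometry.Spec (.of O)) [AlgebraicGeometry.IsIntegral X']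
        [IsLocallyNoetherian X'], Literature.AlgebraicGeometry.Resolution.Scheme.IsRegular X' → AlgebraicGeometry.IsProper r' →
      ∀ (U : X'.Opens), AlgebraicGeometry.Smooth (U.ι ≫ r') →
      ∀ (s : AlgebraicGeometry.Spec (.of O) ⟶ X'), s ≫ r' = 𝟙 _ → s (IsLocalRing.closedPoint O) ∈ U →
      ∀ (X₁ : AlgebraicGeometry.Scheme.{0}) (τ₁ : X₁ ⟶ X'), Literature.AlgebraicGeometry.Resolution.IsBlowup τ₁ s.ker →
      -- the model squares: `F₁` is the special fibre of `X'`, `x` the point under the section, `υ` the blow-up of the reduced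
      -- point `x`, `F₂` the special fibre of `X₁`, the carrier `(ker s · 𝒪_{X₁}) · 𝒪_{F₂} = 𝔪_x · 𝒪_{F₂}`
      ∀ (F₁ : AlgebraicGeometry.Scheme.{0}) [AlgebraicGeometry.IsIntegral F₁] (j : F₁ ⟶ X')
        (t : F₁ ⟶ AlgebraicGeometry.Spec (.of k)),
        IsPullback j t r' (AlgebraicGeometry.Spec.map (CommRingCat.ofHom θ)) →
      ∀ (x : F₁) (hx : IsClosed ({x} : Set F₁)), s (IsLocalRing.closedPoint O) = j x →
      ∀ (F₂ : AlgebraicGeometry.Scheme.{0}) [AlgebraicGeometry.IsIntegral F₂] (υ : F₂ ⟶ F₁),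
        Literature.AlgebraicGeometry.Resolution.IsBlowup υ
          (AlgebraicGeometry.Scheme.IdealSheafData.vanishingIdeal (⟨{x}, hx⟩ : TopologicalSpace.Closeds F₁)) →
      ∀ (j₂ : F₂ ⟶ X₁) (t₂ : F₂ ⟶ AlgebraicGeometry.Spec (.of k)),
        IsPullback j₂ t₂ (τ₁ ≫ r') (AlgebraicGeometry.Spec.map (CommRingCat.ofHom θ)) → j₂ ≫ τ₁ = υ ≫ j →
        (s.ker.comap τ₁).comap j₂ =
          (AlgebraicGeometry.Scheme.IdealSheafData.vanishingIdeal (⟨{x}, hx⟩ : TopologicalSpace.Closeds F₁)).comap υ →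
      ∀ Z : F₂.IdealSheafData, Adm F₁ F₂ υ x Z →
        ∃ C : X₁.IdealSheafData, Literature.AlgebraicGeometry.Resolution.Scheme.IsRegular C.subscheme ∧
          AlgebraicGeometry.Flat (C.subschemeι ≫ τ₁ ≫ r') ∧
          (C.support : Set X₁) ⊆ ((s.ker.comap τ₁).support : Set X₁) ∧ C.comap j₂ = Z) →
    -- the downstairs resolution by (pt) and (pt;Δ) steps
    (∃ (F' : AlgebraicGeometry.Scheme.{0}) (ρ' : F' ⟶ (Literature.AlgebraicGeometry.Motives.projectiveSpace n k).left)
        (T' : Set F'),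
      (∀ Q : (∀ F₁ : AlgebraicGeometry.Scheme.{0}, (F₁ ⟶ (Literature.AlgebraicGeometry.Motives.projectiveSpace n k).left) →
          Set F₁ → Prop),
        Q (Literature.AlgebraicGeometry.Motives.projectiveSpace n k).left
          (𝟙 (Literature.AlgebraicGeometry.Motives.projectiveSpace n k).left) (Set.range ι) →
        (∀ (F₁ F₂ : AlgebraicGeometry.Scheme.{0}) (ρ : F₁ ⟶ (Literature.AlgebraicGeometry.Motives.projectiveSpace n k).left)
            (T₁ : Set F₁)
            (x : ↥(AlgebraicGeometry.Scheme.IdealSheafData.vanishingIdeal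
              (⟨closure T₁, isClosed_closure⟩ : TopologicalSpace.Closeds F₁)).subscheme)
            (υ : F₂ ⟶ F₁)
            (hx : IsClosed ({((AlgebraicGeometry.Scheme.IdealSheafData.vanishingIdeal
              (⟨closure T₁, isClosed_closure⟩ : TopologicalSpace.Closeds F₁)).subschemeι x : F₁)} : Set F₁)),
          Q F₁ ρ T₁ →
          ¬ IsRegularLocalRing ((AlgebraicGeometry.Scheme.IdealSheafData.vanishingIdeal
              (⟨closure T₁, isClosed_closure⟩ : TopologicalSpace.Closeds F₁)).subscheme.presheaf.stalk x) →
          IsRegularLocalRing (F₁.presheaf.stalk ((AlgebraicGeometry.Scheme.IdealSheafData.vanishingIdeal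
              (⟨closure T₁, isClosed_closure⟩ : TopologicalSpace.Closeds F₁)).subschemeι x)) →
          Literature.AlgebraicGeometry.Resolution.IsBlowup υ
            (AlgebraicGeometry.Scheme.IdealSheafData.vanishingIdeal
              (⟨{((AlgebraicGeometry.Scheme.IdealSheafData.vanishingIdeal
                (⟨closure T₁, isClosed_closure⟩ : TopologicalSpace.Closeds F₁)).subschemeι x : F₁)}, hx⟩ :
                TopologicalSpace.Closeds F₁)) →
          Q F₂ (υ ≫ ρ) (closure (υ ⁻¹' (T₁ \ {((AlgebraicGeometry.Scheme.IdealSheafData.vanishingIdeal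
              (⟨closure T₁, isClosed_closure⟩ : TopologicalSpace.Closeds F₁)).subschemeι x : F₁)}))) ∧
          (∀ (F₃ : AlgebraicGeometry.Scheme.{0}) (Z : F₂.IdealSheafData) (υ₂ : F₃ ⟶ F₂),
            Adm F₁ F₂ υ ((AlgebraicGeometry.Scheme.IdealSheafData.vanishingIdeal
                (⟨closure T₁, isClosed_closure⟩ : TopologicalSpace.Closeds F₁)).subschemeι x) Z →
            (Z.support : Set F₂) ⊆ closure (υ ⁻¹' (T₁ \ {((AlgebraicGeometry.Scheme.IdealSheafData.vanishingIdeal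
              (⟨closure T₁, isClosed_closure⟩ : TopologicalSpace.Closeds F₁)).subschemeι x : F₁)})) →
            Literature.AlgebraicGeometry.Resolution.IsBlowup υ₂ Z →
            Q F₃ ((υ₂ ≫ υ) ≫ ρ) (closure (υ₂ ⁻¹' (closure (υ ⁻¹' (T₁ \
              {((AlgebraicGeometry.Scheme.IdealSheafData.vanishingIdeal
                (⟨closure T₁, isClosed_closure⟩ : TopologicalSpace.Closeds F₁)).subschemeι x : F₁)})) \
              (Z.support : Set F₂)))))) →
        Q F' ρ' T') ∧
      Literature.AlgebraicGeometry.Resolution.Scheme.IsRegular (AlgebraicGeometry.Scheme.IdealSheafData.vanishingIdeal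
        (⟨closure T', isClosed_closure⟩ : TopologicalSpace.Closeds F')).subscheme) →
    ∃ (O : Type) (_ : CommRing O) (_ : IsDomain O) (_ : IsDiscreteValuationRing O) (_ : CharZero O) (π : O →+* k),
      Function.Surjective π ∧ (letI := MvPolynomial.gradedAlgebra (σ := Fin (n + 1)) (R := O);
        letI := MvPolynomial.gradedAlgebra (σ := Fin (n + 1)) (R := k);
        ∀ (φ : MvPolynomial.homogeneousSubmodule (Fin (n + 1)) O →+*ᵍ MvPolynomial.homogeneousSubmodule (Fin (n + 1)) k)
          (hφ' : HomogeneousIdeal.irrelevant (MvPolynomial.homogeneousSubmodule (Fin (n + 1)) k) ≤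
            (HomogeneousIdeal.irrelevant (MvPolynomial.homogeneousSubmodule (Fin (n + 1)) O)).map φ),
          (∀ s, φ s = MvPolynomial.map π s) →
          ∀ Y : Set (AlgebraicGeometry.Proj (MvPolynomial.homogeneousSubmodule (Fin (n + 1)) O)),
            Y = Set.range (ι ≫ AlgebraicGeometry.Proj.map φ hφ' :
              H ⟶ AlgebraicGeometry.Proj (MvPolynomial.homogeneousSubmodule (Fin (n + 1)) O)) →
            ∃ (P' : AlgebraicGeometry.Scheme.{0})
              (σ : P' ⟶ AlgebraicGeometry.Proj (MvPolynomial.homogeneousSubmodule (Fin (n + 1)) O)) (S' : Set P'),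
              (∀ Q : (∀ X' : AlgebraicGeometry.Scheme.{0},
                  (X' ⟶ AlgebraicGeometry.Proj (MvPolynomial.homogeneousSubmodule (Fin (n + 1)) O)) → Set X' → Prop),
                Q (AlgebraicGeometry.Proj (MvPolynomial.homogeneousSubmodule (Fin (n + 1)) O)) (𝟙 _) Y →
                (∀ (X' X'' : AlgebraicGeometry.Scheme.{0})
                    (σ' : X' ⟶ AlgebraicGeometry.Proj (MvPolynomial.homogeneousSubmodule (Fin (n + 1)) O)) (Y' : Set X')
                    (C : X'.IdealSheafData) (τ : X'' ⟶ X'),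
                  Q X' σ' Y' → Literature.AlgebraicGeometry.Resolution.IsBlowup τ C →
                  Literature.AlgebraicGeometry.Resolution.Scheme.IsRegular C.subscheme →
                  AlgebraicGeometry.Flat (C.subschemeι ≫ σ' ≫
                    AlgebraicGeometry.Proj.toSpecZero (MvPolynomial.homogeneousSubmodule (Fin (n + 1)) O) ≫
                      AlgebraicGeometry.Spec.map (CommRingCat.ofHom
                        (algebraMap O (MvPolynomial.homogeneousSubmodule (Fin (n + 1)) O 0)))) →
                  σ' '' (C.support : Set X') ⊆ {x | ¬ IsGenericPoint x Y} →
                  (C.support : Set X') ∩ (σ' ≫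
                    AlgebraicGeometry.Proj.toSpecZero (MvPolynomial.homogeneousSubmodule (Fin (n + 1)) O) ≫
                      AlgebraicGeometry.Spec.map (CommRingCat.ofHom
                        (algebraMap O (MvPolynomial.homogeneousSubmodule (Fin (n + 1)) O 0)))) ⁻¹'
                      {IsLocalRing.closedPoint O} ⊆ Y' →
                  Q X'' (τ ≫ σ') (closure (τ ⁻¹' (Y' \ (C.support : Set X'))))) →
                Q P' σ S') ∧
              Literature.AlgebraicGeometry.Resolution.Scheme.IsRegular
                (AlgebraicGeometry.Scheme.IdealSheafData.vanishingIdeal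
                  (⟨closure S', isClosed_closure⟩ : TopologicalSpace.Closeds P')).subscheme) := by
  classical
  intro hp k _ _ _ n H ι hι hH hpr Adm HΔ hres
  obtain ⟨O, i1, i2, i3, i4, i5, i6, π, hπ⟩ := stub_wittRing p hp k
  refine ⟨O, i1, i2, i3, i4, π, hπ, ?_⟩
  letI := MvPolynomial.gradedAlgebra (σ := Fin (n + 1)) (R := O)
  letI := MvPolynomial.gradedAlgebra (σ := Fin (n + 1)) (R := k)
  intro φ hφ' hφ Y hYdef
  subst hYdef
  -- the fixed ambient `P = ℙⁿ_O`, `q`, and the BASE MODEL SQUARE `g : ℙⁿ_k → ℙⁿ_O`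
  set q : Proj (homogeneousSubmodule (Fin (n + 1)) O) ⟶ Spec (.of O) :=
    Proj.toSpecZero (homogeneousSubmodule (Fin (n + 1)) O) ≫
      Spec.map (CommRingCat.ofHom (algebraMap O (homogeneousSubmodule (Fin (n + 1)) O 0))) with hq
  have hP := ProjectiveAmbientFibre.isPullback_projMap π φ hφ hπ hφ'
  set g : Proj (homogeneousSubmodule (Fin (n + 1)) k) ⟶ Proj (homogeneousSubmodule (Fin (n + 1)) O) :=
    Proj.map φ hφ' with hg
  haveI : IsClosedImmersion (Spec.map (CommRingCat.ofHom π)) := IsClosedImmersion.spec_of_surjective _ hπ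
  haveI : IsClosedImmersion g := MorphismProperty.IsStableUnderBaseChange.of_isPullback hP.flip inferInstance
  have hsq₀ : IsPullback g (Proj.toSpecZero (homogeneousSubmodule (Fin (n + 1)) k) ≫
      Spec.map (CommRingCat.ofHom (algebraMap k (homogeneousSubmodule (Fin (n + 1)) k 0))))
      (𝟙 _ ≫ q) (Spec.map (CommRingCat.ofHom π)) := by
    rw [Category.id_comp]; exact hP
  have hrangeg : Set.range g = q ⁻¹' {IsLocalRing.closedPoint O} := by
    rw [range_eq_preimage_of_isPullback hP, range_specMap_of_surjective_of_field π hπ]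
  -- the closed immersion `f = ι ≫ g : H ⟶ ℙⁿ_O` and its (closed) range `Y`
  haveI := hH
  let ι' : H ⟶ Proj (homogeneousSubmodule (Fin (n + 1)) k) := ι
  haveI : IsClosedImmersion ι' := hι
  let f : H ⟶ Proj (homogeneousSubmodule (Fin (n + 1)) O) := ι' ≫ g
  let Yc : Closeds (Proj (homogeneousSubmodule (Fin (n + 1)) O)) := ⟨Set.range f, f.isClosedEmbedding.isClosed_range⟩
  have hYc : (Yc : Set (Proj (homogeneousSubmodule (Fin (n + 1)) O))) = Set.range (ι ≫ Proj.map φ hφ') := rfl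
  have hsub : (Yc : Set (Proj (homogeneousSubmodule (Fin (n + 1)) O))) ⊆ q ⁻¹' {IsLocalRing.closedPoint O} := by
    rintro _ ⟨x, rfl⟩
    rw [← hrangeg]
    exact ⟨ι' x, (Scheme.Hom.comp_apply _ _ x).symm⟩
  obtain ⟨hsm, hprop⟩ := stub_projectiveAmbientSmoothProper O n
  haveI : IsProper q := hprop
  -- `Y` is irreducible (image of the integral `H`)
  have hYirr : IsIrreducible (Yc : Set (Proj (homogeneousSubmodule (Fin (n + 1)) O))) := by
    have h := (IrreducibleSpace.isIrreducible_univ H).image f f.continuous.continuousOn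
    rwa [Set.image_univ] at h
  obtain ⟨ξ, hξ⟩ : ∃ ξ : Proj (homogeneousSubmodule (Fin (n + 1)) O), IsGenericPoint ξ (Yc : Set _) :=
    QuasiSober.sober hYirr Yc.isClosed
  -- EL♮'s HORIZONTAL induction principle as a stage predicate over the fixed base
  obtain ⟨Ch, hCh⟩ : ∃ Ch : ∀ X' : Scheme.{0}, (X' ⟶ Proj (homogeneousSubmodule (Fin (n + 1)) O)) → Set X' → Prop,
      ∀ (X₁ : Scheme.{0}) (σ₁ : X₁ ⟶ Proj (homogeneousSubmodule (Fin (n + 1)) O)) (S₁ : Set X₁), Ch X₁ σ₁ S₁ ↔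
      ∀ Q : (∀ X' : Scheme.{0}, (X' ⟶ Proj (homogeneousSubmodule (Fin (n + 1)) O)) → Set X' → Prop),
        Q (Proj (homogeneousSubmodule (Fin (n + 1)) O)) (𝟙 _) (Yc : Set (Proj (homogeneousSubmodule (Fin (n + 1)) O))) →
        (∀ (X' X'' : Scheme.{0}) (σ' : X' ⟶ Proj (homogeneousSubmodule (Fin (n + 1)) O)) (Y' : Set X')
          (C : X'.IdealSheafData) (τ : X'' ⟶ X'), Q X' σ' Y' → IsBlowup τ C → Scheme.IsRegular C.subscheme →
          Flat (C.subschemeι ≫ σ' ≫ q) →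
          σ' '' (C.support : Set X') ⊆ {x | ¬ IsGenericPoint x (Yc : Set (Proj (homogeneousSubmodule (Fin (n + 1)) O)))} →
          (C.support : Set X') ∩ (σ' ≫ q) ⁻¹' {IsLocalRing.closedPoint O} ⊆ Y' →
          Q X'' (τ ≫ σ') (closure (τ ⁻¹' (Y' \ (C.support : Set X'))))) →
        Q X₁ σ₁ S₁ := ⟨_, fun _ _ _ => Iff.rfl⟩
  have hChain : ∀ (X' : Scheme.{0}) (σ : X' ⟶ Proj (homogeneousSubmodule (Fin (n + 1)) O)) (S : Set X'),
      Ch X' σ S → Chain (Proj (homogeneousSubmodule (Fin (n + 1)) O))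
        (Yc : Set (Proj (homogeneousSubmodule (Fin (n + 1)) O))) X' σ S :=
    fun X' σ S h Q h0 hs => (hCh X' σ S).mp h Q h0
      (fun X₁ X₂ σ' Y' C τ hQ hb hr _ hg' _ => hs X₁ X₂ σ' Y' C τ hQ hb hr hg')
  have hStep : ∀ (X' X'' : Scheme.{0}) (σ' : X' ⟶ Proj (homogeneousSubmodule (Fin (n + 1)) O)) (S' : Set X')
      (C : X'.IdealSheafData) (τ : X'' ⟶ X'),
      Ch X' σ' S' → IsBlowup τ C → Scheme.IsRegular C.subscheme → Flat (C.subschemeι ≫ σ' ≫ q) →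
      σ' '' (C.support : Set X') ⊆ {x | ¬ IsGenericPoint x (Yc : Set (Proj (homogeneousSubmodule (Fin (n + 1)) O)))} →
      (C.support : Set X') ∩ (σ' ≫ q) ⁻¹' {IsLocalRing.closedPoint O} ⊆ S' →
      Ch X'' (τ ≫ σ') (closure (τ ⁻¹' (S' \ (C.support : Set X')))) :=
    fun X' X'' σ' S' C τ h hb hr hfl hg' hE => (hCh _ _ _).mpr fun Q h0 hs =>
      hs X' X'' σ' S' C τ ((hCh X' σ' S').mp h Q h0 hs) hb hr hfl hg' hE
  have hCh₀ : Ch (Proj (homogeneousSubmodule (Fin (n + 1)) O)) (𝟙 _)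
      (Yc : Set (Proj (homogeneousSubmodule (Fin (n + 1)) O))) := (hCh _ _ _).mpr fun Q h0 _ => h0
  have hPnoeth : IsLocallyNoetherian (Proj (homogeneousSubmodule (Fin (n + 1)) O)) :=
    LocallyOfFiniteType.isLocallyNoetherian q
  have hPreg : Scheme.IsRegular (Proj (homogeneousSubmodule (Fin (n + 1)) O)) := fun y => (stub_goodAtOfSmooth O _ q hsm y).1
  -- THE INDUCTION PREDICATE: closed irreducible strict transform in an integral ambient which IS the special fibre of an upstairs
  -- horizontal-E1 stage (the MODEL SQUARE), with matching strict-transform sets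
  let QD : ∀ F₁ : Scheme.{0}, (F₁ ⟶ (Literature.AlgebraicGeometry.Motives.projectiveSpace n k).left) → Set F₁ → Prop :=
    fun F₁ _ T₁ => IsClosed T₁ ∧ IsIrreducible T₁ ∧ IsIntegral F₁ ∧
      ∃ (X' : Scheme.{0}) (σ' : X' ⟶ Proj (homogeneousSubmodule (Fin (n + 1)) O)) (S' : Set X')
        (j : F₁ ⟶ X') (t : F₁ ⟶ Spec (.of k)),
        Ch X' σ' S' ∧ IsIntegral X' ∧ IsLocallyNoetherian X' ∧ Scheme.IsRegular X' ∧ IsDominant (σ' ≫ q) ∧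
        IsPullback j t (σ' ≫ q) (Spec.map (CommRingCat.ofHom π)) ∧ j '' T₁ = S'
  -- THE INDUCTION along the downstairs closure
  obtain ⟨F', ρ', T', hclos, hregD⟩ := hres
  have hQD : QD F' ρ' T' := by
    refine hclos QD ?_ ?_
    · -- BASE: `(ℙⁿ_k, 𝟙, range ι)` IS the special fibre of `(ℙⁿ_O, 𝟙, Y)`
      haveI : Nonempty H := inferInstance
      haveI : Nonempty (Proj (homogeneousSubmodule (Fin (n + 1)) O)) := ⟨f (Classical.arbitrary H)⟩
      haveI : Smooth q := hsm
      haveI : IsDominant q := isDominant_of_smooth_of_nonempty q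
      have hdom₀ : IsDominant (𝟙 (Proj (homogeneousSubmodule (Fin (n + 1)) O)) ≫ q) := by
        rw [Category.id_comp]; infer_instance
      have hirrι : IsIrreducible (Set.range ι') := by
        have h := (IrreducibleSpace.isIrreducible_univ H).image ι' ι'.continuous.continuousOn
        rwa [Set.image_univ] at h
      refine ⟨ι'.isClosedEmbedding.isClosed_range, hirrι, isIntegral_proj_homogeneousSubmodule n k, _, 𝟙 _,
        (Yc : Set (Proj (homogeneousSubmodule (Fin (n + 1)) O))), g, _, hCh₀,
        Proj.isIntegral _ (irrelevant_homogeneousSubmodule_ne_bot n O), hPnoeth, hPreg, hdom₀, hsq₀, ?_⟩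
      change g '' Set.range ι' = Set.range f
      rw [← Set.range_comp]
      rfl
    · -- STEPS
      intro F₁ F₂ ρ T₁ x υ hx hQ₁ hxreg hFreg hυ
      obtain ⟨hT₁cl, hT₁irr, hF₁, X', σ', S', j, t, hChX, hX'int, hX'noeth, hX'reg, hdom, hsq, hTS⟩ := hQ₁
      haveI := hF₁
      haveI := hX'int
      haveI := hX'noeth
      obtain ⟨hF₂, hT₂irr, U, s, X'', τ, j₂, t₂, hproper, hU, hs, hsU, hss₀, hoffs, hτ, hcomm, hE, hCh'', hint'', hnoeth'',
        hreg'', hdom'', hsq₂⟩ := modelPointStep_chain' O k π hπ _ q (Yc : Set (Proj (homogeneousSubmodule (Fin (n + 1)) O))) hsub hYirr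
          Yc.isClosed hPnoeth hPreg Ch hChain hStep X' σ' S' hChX hX'reg hdom F₁ j t hsq T₁ hT₁cl hT₁irr hTS x hx hxreg hFreg
          F₂ υ hυ
      haveI := hF₂
      haveI := hint''
      haveI := hnoeth''
      haveI hj₂ci : IsClosedImmersion j₂ := MorphismProperty.IsStableUnderBaseChange.of_isPullback hsq₂.flip inferInstance
      refine ⟨⟨isClosed_closure, hT₂irr, hF₂, X'', τ ≫ σ', _, j₂, t₂, hCh'', hint'', hnoeth'', hreg'', hdom'', hsq₂, rfl⟩, ?_⟩
      -- the Δ-step in the fresh carrier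
      intro F₃ Z υ₂ hAdm hZT hυ₂
      have hsq₂' : IsPullback j₂ t₂ (τ ≫ σ' ≫ q) (Spec.map (CommRingCat.ofHom π)) := by
        simpa only [Category.assoc] using hsq₂
      obtain ⟨C, hCreg, hCflat, hCsuppE, hCZ⟩ :=
        HΔ O π hπ X' (σ' ≫ q) hX'reg hproper U hU s hs hsU X'' τ hτ F₁ j t hsq _ hx hss₀ F₂ υ hυ j₂ t₂ hsq₂' hcomm hE Z hAdm
      have hCflat' : Flat (C.subschemeι ≫ (τ ≫ σ') ≫ q) := by simpa only [Category.assoc] using hCflat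
      -- `T₂ ⊄ supp Z`: the lift puts `supp Z` inside the exceptional locus `υ⁻¹{x}`, and `T₂` has a point outside it
      set xF : F₁ := (vanishingIdeal (⟨closure T₁, isClosed_closure⟩ : Closeds F₁)).subschemeι x with hxF
      have hTZ : ¬ closure (υ ⁻¹' (T₁ \ {xF})) ⊆ (Z.support : Set F₂) := by
        have hZe : (Z.support : Set F₂) ⊆ υ ⁻¹' {xF} := by
          intro z hz
          have hz' : j₂ z ∈ (C.support : Set X'') := by
            rw [← hCZ, Scheme.IdealSheafData.support_comap] at hz
            exact hz
          have h2 : z ∈ (((s.ker.comap τ).comap j₂).support : Set F₂) := by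
            rw [Scheme.IdealSheafData.support_comap]
            exact hCsuppE hz'
          rw [hE, Scheme.IdealSheafData.support_comap, TopologicalSpace.Closeds.coe_preimage, coe_support_vanishingIdeal] at h2
          exact h2
        -- `xF` is not all of `T₁`
        have hclT₁ : closure T₁ = T₁ := hT₁cl.closure_eq
        have hrangeι : Set.range (vanishingIdeal (⟨closure T₁, isClosed_closure⟩ : Closeds F₁)).subschemeι = closure T₁ := by
          rw [range_subschemeι, coe_support_vanishingIdeal]; rfl
        have hxT : xF ∈ T₁ := by
          rw [← hclT₁, ← hrangeι]; exact ⟨x, rfl⟩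
        have hxgen : ¬ IsGenericPoint xF T₁ := by
          have hT₁irr' : IsIrreducible (closure T₁) := by rw [hclT₁]; exact hT₁irr
          have h := not_isGenericPoint_of_not_isRegularLocalRing (⟨closure T₁, isClosed_closure⟩ : Closeds F₁) hT₁irr' x hxreg
          rwa [show ((⟨closure T₁, isClosed_closure⟩ : Closeds F₁) : Set F₁) = T₁ from hclT₁] at h
        have hTx : ¬ T₁ ⊆ {xF} := not_subset_singleton_of_not_isGenericPoint hT₁cl hxT hxgen
        obtain ⟨y, hyT, hyx⟩ : ∃ y ∈ T₁, y ≠ xF := by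
          by_contra h
          exact hTx fun y hy => by_contra fun hne => h ⟨y, hy, hne⟩
        -- `υ` is an isomorphism off `xF`: `y` has a preimage
        haveI : IsIso (υ ∣_ centreCompl (vanishingIdeal ⟨{xF}, hx⟩ : F₁.IdealSheafData)) := hυ.isIso_compl
        have hyc : y ∈ (centreCompl (vanishingIdeal ⟨{xF}, hx⟩ : F₁.IdealSheafData) : F₁.Opens) := by
          change y ∈ ((vanishingIdeal ⟨{xF}, hx⟩ : F₁.IdealSheafData).support : Set F₁)ᶜ
          rw [coe_support_vanishingIdeal]
          exact hyx
        obtain ⟨z, hz⟩ := (υ ∣_ centreCompl (vanishingIdeal ⟨{xF}, hx⟩ : F₁.IdealSheafData)).surjective ⟨y, hyc⟩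
        have hυz : υ z.1 = y := by
          have h := morphismRestrict_base_coe υ (centreCompl (vanishingIdeal ⟨{xF}, hx⟩ : F₁.IdealSheafData)) z
          rw [hz] at h
          exact h.symm
        intro hsub
        have hzT : z.1 ∈ closure (υ ⁻¹' (T₁ \ {xF})) := by
          refine subset_closure ?_
          rw [Set.mem_preimage, hυz]
          exact ⟨hyT, hyx⟩
        have hzx : υ z.1 = xF := hZe (hsub hzT)
        exact hyx (hυz.symm.trans hzx)
      have hoffC : (τ ≫ σ') '' (C.support : Set X'') ⊆
          {y | ¬ IsGenericPoint y (Yc : Set (Proj (homogeneousSubmodule (Fin (n + 1)) O)))} := by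
        rintro _ ⟨c, hc, rfl⟩
        have hc' : τ c ∈ (s.ker.support : Set X') := by
          have := hCsuppE hc
          rw [SetLike.mem_coe, Scheme.IdealSheafData.support_comap] at this
          exact this
        rw [Scheme.Hom.comp_apply]
        exact hoffs _ hc'
      obtain ⟨X₃, τ₂, hτ₂⟩ := exists_isBlowup X'' C
      obtain ⟨hCh₃, hreg₃, hnoeth₃, j₃, t₃, hsq₃, -, hsets₃⟩ :=
        modelStep O k π hπ _ q (Yc : Set (Proj (homogeneousSubmodule (Fin (n + 1)) O))) Ch hStep X'' (τ ≫ σ') _ hCh''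
          hreg'' F₂ j₂ t₂ hsq₂ _ rfl C Z hCZ hCreg hCflat' hoffC hZT X₃ τ₂ hτ₂ F₃ υ₂ hυ₂
      -- integrality and dominance of the new stages; irreducibility of the new strict transform
      have hZne : Z ≠ ⊥ := by
        intro h
        apply hTZ
        rw [h, Scheme.IdealSheafData.support_bot]
        exact Set.subset_univ _
      have hCne : C ≠ ⊥ := by
        intro h
        apply hZne
        rw [← hCZ, h]
        ext U : 2
        simp [Scheme.IdealSheafData.comap]
      haveI hint₃ : IsIntegral X₃ := hτ₂.isIntegral hCne
      haveI : IsDominant τ₂ := isDominant_of_isBlowup hτ₂ hCne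
      haveI : IsDominant ((τ ≫ σ') ≫ q) := hdom''
      have hdom₃ : IsDominant ((τ₂ ≫ τ ≫ σ') ≫ q) := by
        have : IsDominant (τ₂ ≫ (τ ≫ σ') ≫ q) := inferInstance
        simpa only [Category.assoc] using this
      haveI hF₃ : IsIntegral F₃ := hυ₂.isIntegral hZne
      haveI hj₃ci : IsClosedImmersion j₃ := MorphismProperty.IsStableUnderBaseChange.of_isPullback hsq₃.flip inferInstance
      have hT₃irr : IsIrreducible (closure (υ₂ ⁻¹' (closure (υ ⁻¹' (T₁ \
          {((vanishingIdeal (⟨closure T₁, isClosed_closure⟩ : Closeds F₁)).subschemeι x : F₁)})) \ (Z.support : Set F₂)))) :=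
        isIrreducible_of_model hYirr Yc.isClosed (hChain _ _ _ hCh₃) j₃ _ isClosed_closure hsets₃
      have hsq₃' : IsPullback j₃ t₃ ((τ₂ ≫ τ ≫ σ') ≫ q) (Spec.map (CommRingCat.ofHom π)) := by
        simpa only [Category.assoc] using hsq₃
      refine ⟨isClosed_closure, hT₃irr, hF₃, X₃, τ₂ ≫ τ ≫ σ', _, j₃, t₃, ?_, hint₃, hnoeth₃, hreg₃, hdom₃, hsq₃', hsets₃⟩
      simpa only [Category.assoc] using hCh₃
  -- THE END: transport the downstairs regularity through the model
  obtain ⟨hT'cl, -, -, X₁, σ₁, S₁, j₁, t₁, hCh₁, -, -, -, -, hsq₁, hTS₁⟩ := hQD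
  haveI hj₁ci : IsClosedImmersion j₁ := MorphismProperty.IsStableUnderBaseChange.of_isPullback hsq₁.flip inferInstance
  have hT'img : IsClosed (j₁ '' T') := hj₁ci.isClosedEmbedding.isClosedMap _ hT'cl
  have hZ1 : (⟨closure T', isClosed_closure⟩ : Closeds F') = ⟨T', hT'cl⟩ := Closeds.ext hT'cl.closure_eq
  have hZ2 : (⟨closure S₁, isClosed_closure⟩ : Closeds X₁) = ⟨j₁ '' T', hT'img⟩ :=
    Closeds.ext (by change closure S₁ = j₁ '' T'; rw [← hTS₁]; exact hT'img.closure_eq)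
  rw [hZ1] at hregD
  refine ⟨X₁, σ₁, S₁, (hCh X₁ σ₁ S₁).mp hCh₁, ?_⟩
  rw [hZ2]
  exact (isRegular_subscheme_vanishingIdeal_image_iff j₁ ⟨T', hT'cl⟩ hT'img).mpr hregD

end Summit.ResolutionOfSingularities.ResolutionOfSingularities.Cruxes.EquisingularLiftNat.Sections

end
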